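import Mathlib.Computability.Encoding
import Mathlib.Computability.TuringMachine.Computable
import Mathlib.Algebra.Ring.Rat
import Mathlib.Data.Nat.Log
import Literature.Computability.Complexity.BoolEncodings
import Literature.Computability.Complexity.GraphEncodings
import Literature.Algebra.EuclideanLattices.IntegerBases
import Literature.Algebra.EuclideanLattices.Problems
import HarnessLib

-- provenance: harness21/H21/H21/Prelude/Lattice/Encoding.lean @ ff58917 (interim HEAD d8f2665); M5 mechanical rewrite
/-!
# Boolean encodings of lattice problem instances

Trunk: Lattice (prelude), item `LatticeEncoding` (concept C5 of the Lattice outline); the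
encoding half of the notions `lattice_problems_svp_cvp` / `lll_reduced_basis`.

We fix, once and for all, how the inputs and outputs of the computational lattice problems
(integer basis matrices `B ∈ ℤⁿˣⁿ`, integer vectors, rational thresholds) are written as bit
strings, in the format consumed by Mathlib's `Turing.TM2ComputableInPolyTime (ea : α → List Bool)
(eb : β → List Bool) f` and by G01's `PolyTimeComputable` / `Encoding.toLanguage`.

Since G01's item `BoolEncodings` is accepted, everything is BUILT from its combinators
(`Computability.Encoding.pairBool`, `.listBool`, `.sigmaBool`, `.ofEquiv`,
`Literature.Computability.Complexity.encodingIntBool`, `Literature.Computability.Complexity.encodingFinVec`) on top of Mathlib's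
`Computability.Encoding`, `encodingNatBool`, `encodeNat`/`decodeNat`; the plain encoders
`encodeInt`, `encodeIntVec`, `encodeRat`, `LatticeInstance.encode`, … are the `.encode` fields
of genuine `Computability.Encoding _ Bool` structures (with real `decode_encode` proofs), so
injectivity is Mathlib's `Computability.Encoding.encode_injective`.

## Main definitions

* `encodingIntVecFin n`, `encodingIntMatrixFin n`, `intVecEncoding`, `encodingRatBool`:
  encodings of `ℤⁿ`, `ℤⁿˣⁿ`, `Σ n, ℤⁿ`, `ℚ`;
* `latticeInstanceEncoding`, `gapSVPInstanceEncoding`, `cvpInstanceEncoding`,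
  `gapCVPInstanceEncoding`: encodings of the instance types of `Literature.Prelude.Lattice.Problems`;
* plain encoders `encodeNatSD`, `encodeInt`, `encodeIntVec`, `encodeRat`,
  `LatticeInstance.encode`, `GapSVPInstance.encode`, `CVPInstance.encode`,
  `GapCVPInstance.encode`, and the total decoder `decodeIntVec n` (junk value `0`).

## Encoding scheme (documented, cf. Arora–Barak 2009, §0.1)

* naturals: Mathlib binary `encodeNat` (little-endian, `encodeNat 0 = []`); the
  self-delimiting variant `encodeNatSD n` doubles every bit and appends the terminator `01`
  (`= boolPair (encodeNat n) []`), which is exactly the length/dimension header written by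
  `sigmaBool`;
* integers: `boolPair [z < 0] (encodeNat |z|)` (G01 `encodingIntBool`);
* rationals: `boolPair (encodeInt q.num) (encodeNat q.den)` (reduced fraction, so injective);
* vectors `ℤⁿ`: G01 `encodingFinVec encodingIntBool n` (unary length header, then the entries,
  each `boolPair`-delimited); matrices `ℤⁿˣⁿ`: the row-major vector of length `n * n`;
* `LatticeInstance ⟨n, B⟩ ↦ boolPair (encodeNat n) (code of B)` (`sigmaBool`), and pairs
  (instance, threshold) / (instance, target) by `pairBool`.

Sources: Micciancio–Goldwasser, *Complexity of Lattice Problems* (2002), Ch. 1, §1.2–1.3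
(input size of lattice problems = number of bits of the integer basis); Arora–Barak,
*Computational Complexity* (2009), §0.1 (representing objects as strings); Mathlib
`Mathlib/Computability/Encoding.lean`.

Design choices: `Fin n`-indexed data are packaged as `Σ n, …` before encoding (the TM2 API is
`Type`-monomorphic and inputs of all dimensions form one language). `decodeIntVec n` returns
the junk value `0` on malformed words or words of the wrong dimension (documented; only
`decodeIntVec_encodeIntVec` is ever used). `LatticeInstance.maxEntry` uses `Finset.sup` over
`Fin n × Fin n`, which is `0` for `n = 0` (harmless: it only enters a size bound).
-/

namespace Literature.Algebra.EuclideanLattices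

open _root_.Computability Literature.Computability.Complexity

/-! ### Building blocks: naturals, integers, rationals, integer vectors and matrices -/

/-- Self-delimiting binary code of a natural number: every bit of Mathlib's `encodeNat n` is
doubled and the terminator `false, true` is appended; equals `boolPair (encodeNat n) []` and is
the dimension header of all `sigmaBool`-encodings below (Arora–Barak 2009, §0.1). [cite: AroraBarak2009, §0.1] -/
def encodeNatSD (n : ℕ) : List Bool :=
  ((encodeNat n).flatMap fun b => [b, b]) ++ [false, true]

/-- `boolPair (encodeNat n) w = encodeNatSD n ++ w`: the self-delimiting code is a prefix code
followed verbatim by the payload (Arora–Barak 2009, §0.1). [cite: AroraBarak2009, §0.1] -/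
theorem boolPair_encodeNat (n : ℕ) (w : List Bool) :
    boolPair (encodeNat n) w = encodeNatSD n ++ w := by
  simp [boolPair, encodeNatSD]

/-- Integer vectors `ℤⁿ` (fixed `n`) over `Bool`: G01's `encodingFinVec encodingIntBool n`
(unary length header, `boolPair`-delimited entries; Arora–Barak 2009, §0.1). [cite: AroraBarak2009, §0.1] -/
def encodingIntVecFin (n : ℕ) : Encoding (Fin n → ℤ) Bool :=
  encodingFinVec encodingIntBool n

/-- Integer matrices `ℤⁿˣⁿ` (fixed `n`) over `Bool`: the row-major vector of the `n * n`
entries (`encodingFinVec encodingIntBool (n * n)`), transported along `Matrix.of`, currying and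
`finProdFinEquiv` (Micciancio–Goldwasser 2002, Ch. 1, §1.2; Arora–Barak 2009, §0.1). [cite: MicciancioGoldwasser2002, Ch. 1  §1.2] -/
def encodingIntMatrixFin (n : ℕ) : Encoding (Matrix (Fin n) (Fin n) ℤ) Bool :=
  (encodingFinVec encodingIntBool (n * n)).ofEquiv
    (Matrix.of.symm.trans
      ((Equiv.curry (Fin n) (Fin n) ℤ).symm.trans (finProdFinEquiv.arrowCongr (Equiv.refl ℤ))))

/-- Integer vectors of all dimensions, `Σ n, ℤⁿ`, over `Bool`:
`⟨n, v⟩ ↦ boolPair (encodeNat n) (code of v)` (`sigmaBool encodingIntVecFin`). This is the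
output format of lattice algorithms (LLL, Babai, SVP/CVP solvers). (Arora–Barak 2009, §0.1.) [cite: AroraBarak2009, §0.1] -/
def intVecEncoding : Encoding (Σ n, Fin n → ℤ) Bool :=
  Encoding.sigmaBool encodingIntVecFin

/-- Rationals over `Bool`: the reduced fraction `(q.num, q.den)` encoded with
`encodingIntBool.pairBool encodingNatBool`; decoding is `(a, b) ↦ a / b`, a left inverse by
`Rat.num_div_den` (Arora–Barak 2009, §0.1; Micciancio–Goldwasser 2002, Ch. 1, §1.2, rational
inputs). [cite: AroraBarak2009, §0.1] -/
def encodingRatBool : Encoding ℚ Bool where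
  encode q := (encodingIntBool.pairBool encodingNatBool).encode (q.num, q.den)
  decode w := ((encodingIntBool.pairBool encodingNatBool).decode w).map
    fun p => (p.1 : ℚ) / (p.2 : ℚ)
  decode_encode q := by
    rw [(encodingIntBool.pairBool encodingNatBool).decode_encode]
    simp [Rat.num_div_den]

/-! ### Instance types as sigma types -/

/-- `LatticeInstance ≃ Σ n, ℤⁿˣⁿ` (a lattice instance is a dimension and a basis matrix;
Micciancio–Goldwasser 2002, Ch. 1, Def. 1.1). [cite: MicciancioGoldwasser2002, Ch. 1  Def. 1.1] -/
def LatticeInstance.equivSigma : LatticeInstance ≃ Σ n, Matrix (Fin n) (Fin n) ℤ where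
  toFun I := ⟨I.n, I.basis⟩
  invFun p := ⟨p.1, p.2⟩
  left_inv _ := rfl
  right_inv _ := rfl

/-- `CVPInstance ≃ Σ n, ℤⁿˣⁿ × ℤⁿ` (a CVP instance is a dimension, a basis matrix and a target;
Micciancio–Goldwasser 2002, Ch. 1, Def. 1.2). [cite: MicciancioGoldwasser2002, Ch. 1  Def. 1.2] -/
def CVPInstance.equivSigma : CVPInstance ≃ Σ n, Matrix (Fin n) (Fin n) ℤ × (Fin n → ℤ) where
  toFun c := ⟨c.I.n, (c.I.basis, c.target)⟩
  invFun p := ⟨⟨p.1, p.2.1⟩, p.2.2⟩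
  left_inv _ := rfl
  right_inv _ := rfl

/-! ### Encodings of the instance types -/

/-- Lattice instances over `Bool`: `⟨n, B⟩ ↦ boolPair (encodeNat n) (row-major code of B)`,
i.e. `sigmaBool encodingIntMatrixFin` transported along `LatticeInstance.equivSigma`
(Micciancio–Goldwasser 2002, Ch. 1, §1.2 (size of a lattice instance); Arora–Barak 2009,
§0.1). [cite: MicciancioGoldwasser2002, Ch. 1  §1.2 (size of a lattice instance] -/
def latticeInstanceEncoding : Encoding LatticeInstance Bool :=
  (Encoding.sigmaBool encodingIntMatrixFin).ofEquiv LatticeInstance.equivSigma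

/-- `GapSVP` instances `(B, d)` over `Bool`: `pairBool` of the lattice instance and the rational
threshold (Micciancio–Goldwasser 2002, Ch. 1, Def. 1.4 / §1.2). [cite: MicciancioGoldwasser2002, Ch. 1  Def. 1.4 / §1.2] -/
def gapSVPInstanceEncoding : Encoding GapSVPInstance Bool :=
  latticeInstanceEncoding.pairBool encodingRatBool

/-- CVP instances `(B, t)` over `Bool`: `⟨n, (B, t)⟩ ↦ boolPair (encodeNat n) (boolPair (code
of B) (code of t))`, i.e. `sigmaBool (fun n => (encodingIntMatrixFin n).pairBool
(encodingIntVecFin n))` transported along `CVPInstance.equivSigma` (Micciancio–Goldwasser 2002,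
Ch. 1, Def. 1.2 / §1.2). [cite: MicciancioGoldwasser2002, Ch. 1  Def. 1.2 / §1.2] -/
def cvpInstanceEncoding : Encoding CVPInstance Bool :=
  (Encoding.sigmaBool fun n => (encodingIntMatrixFin n).pairBool (encodingIntVecFin n)).ofEquiv
    CVPInstance.equivSigma

/-- `GapCVP` instances `((B, t), d)` over `Bool`: `pairBool` of the CVP instance and the
rational threshold (Micciancio–Goldwasser 2002, Ch. 1, Def. 1.5 / §1.2). [cite: MicciancioGoldwasser2002, Ch. 1  Def. 1.5 / §1.2] -/
def gapCVPInstanceEncoding : Encoding GapCVPInstance Bool :=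
  cvpInstanceEncoding.pairBool encodingRatBool

/-! ### Plain encoders and decoders (the `List Bool`-valued functions fed to `TM2ComputableInPolyTime`) -/

/-- The bit string of an integer (sign bit paired with binary absolute value; G01
`encodingIntBool`; Arora–Barak 2009, §0.1). [cite: AroraBarak2009, §0.1] -/
def encodeInt : ℤ → List Bool := encodingIntBool.encode

/-- The bit string of an integer vector of any dimension, `⟨n, v⟩ ↦ boolPair (encodeNat n)
(code of v)` (`intVecEncoding.encode`; Arora–Barak 2009, §0.1). [cite: AroraBarak2009, §0.1] -/
def encodeIntVec : (Σ n, Fin n → ℤ) → List Bool := intVecEncoding.encode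

/-- The bit string of a rational number (reduced numerator and denominator;
`encodingRatBool.encode`; Arora–Barak 2009, §0.1). [cite: AroraBarak2009, §0.1] -/
def encodeRat : ℚ → List Bool := encodingRatBool.encode

/-- Total decoder for integer vectors of a prescribed dimension `n`: decode `w` with
`intVecEncoding`; if it is the code of some `⟨n, v⟩` return `v`, otherwise (malformed word or
wrong dimension) return the JUNK value `0`. Used to read outputs of lattice algorithms;
only `decodeIntVec_encodeIntVec` is relied upon (Arora–Barak 2009, §0.1). [cite: AroraBarak2009, §0.1] -/
def decodeIntVec (n : ℕ) (w : List Bool) : Fin n → ℤ :=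
  match intVecEncoding.decode w with
  | some p => if h : p.1 = n then fun i => p.2 (i.cast h.symm) else 0
  | none => 0

/-- The bit string of a lattice instance (`latticeInstanceEncoding.encode`;
Micciancio–Goldwasser 2002, Ch. 1, §1.2). [cite: MicciancioGoldwasser2002, Ch. 1  §1.2] -/
def LatticeInstance.encode : LatticeInstance → List Bool := latticeInstanceEncoding.encode

/-- The bit string of a `GapSVP` instance (`gapSVPInstanceEncoding.encode`;
Micciancio–Goldwasser 2002, Ch. 1, §1.2). [cite: MicciancioGoldwasser2002, Ch. 1  §1.2] -/
def GapSVPInstance.encode : GapSVPInstance → List Bool := gapSVPInstanceEncoding.encode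

/-- The bit string of a CVP instance (`cvpInstanceEncoding.encode`; Micciancio–Goldwasser 2002,
Ch. 1, §1.2). [cite: MicciancioGoldwasser2002, Ch. 1  §1.2] -/
def CVPInstance.encode : CVPInstance → List Bool := cvpInstanceEncoding.encode

/-- The bit string of a `GapCVP` instance (`gapCVPInstanceEncoding.encode`;
Micciancio–Goldwasser 2002, Ch. 1, §1.2). [cite: MicciancioGoldwasser2002, Ch. 1  §1.2] -/
def GapCVPInstance.encode : GapCVPInstance → List Bool := gapCVPInstanceEncoding.encode

/-! ### API: unfolding, decoding, injectivity, size -/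

/-- Unfolding: the code of a lattice instance is the self-delimiting dimension header followed
by the row-major code of the basis matrix (Arora–Barak 2009, §0.1). [cite: AroraBarak2009, §0.1] -/
theorem LatticeInstance.encode_eq (I : LatticeInstance) :
    I.encode = encodeNatSD I.n ++ (encodingIntMatrixFin I.n).encode I.basis := by
  rw [← boolPair_encodeNat]; rfl

/-- Unfolding: `encodeIntVec ⟨n, v⟩ = encodeNatSD n ++ code of v` (Arora–Barak 2009, §0.1). [cite: AroraBarak2009, §0.1] -/
theorem encodeIntVec_eq (n : ℕ) (v : Fin n → ℤ) :
    encodeIntVec ⟨n, v⟩ = encodeNatSD n ++ (encodingIntVecFin n).encode v := by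
  rw [← boolPair_encodeNat]; rfl

/-- `decodeIntVec n` is a left inverse of `encodeIntVec` on dimension-`n` vectors
(Mathlib `Computability.Encoding.decode_encode`). [folklore] -/
@[simp] theorem decodeIntVec_encodeIntVec (n : ℕ) (v : Fin n → ℤ) :
    decodeIntVec n (encodeIntVec ⟨n, v⟩) = v := by
  unfold decodeIntVec encodeIntVec
  rw [intVecEncoding.decode_encode]
  simp

/-- `encodeInt` is injective (Mathlib `Computability.Encoding.encode_injective`). [folklore] -/
theorem encodeInt_injective : Function.Injective encodeInt :=
  encodingIntBool.encode_injective

/-- `encodeIntVec` is injective (Mathlib `Computability.Encoding.encode_injective`). [folklore] -/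
theorem encodeIntVec_injective : Function.Injective encodeIntVec :=
  intVecEncoding.encode_injective

/-- `encodeRat` is injective (Mathlib `Computability.Encoding.encode_injective`). [folklore] -/
theorem encodeRat_injective : Function.Injective encodeRat :=
  encodingRatBool.encode_injective

/-- `LatticeInstance.encode` is injective (Mathlib `Computability.Encoding.encode_injective`). [folklore] -/
theorem LatticeInstance.encode_injective : Function.Injective LatticeInstance.encode :=
  latticeInstanceEncoding.encode_injective

/-- `GapSVPInstance.encode` is injective (Mathlib `Computability.Encoding.encode_injective`). [folklore] -/
theorem GapSVPInstance.encode_injective : Function.Injective GapSVPInstance.encode :=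
  gapSVPInstanceEncoding.encode_injective

/-- `CVPInstance.encode` is injective (Mathlib `Computability.Encoding.encode_injective`). [folklore] -/
theorem CVPInstance.encode_injective : Function.Injective CVPInstance.encode :=
  cvpInstanceEncoding.encode_injective

/-- `GapCVPInstance.encode` is injective (Mathlib `Computability.Encoding.encode_injective`). [folklore] -/
theorem GapCVPInstance.encode_injective : Function.Injective GapCVPInstance.encode :=
  gapCVPInstanceEncoding.encode_injective

/-- The largest absolute value `max_{i,j} |B i j|` of an entry of the basis matrix (the
quantity `M` in the input-size bound `size(B) = poly(n, log M)`; Micciancio–Goldwasser 2002,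
Ch. 1, §1.3).  By the `Finset.sup` convention it is `0` for the empty matrix (`n = 0`). [cite: MicciancioGoldwasser2002, Ch. 1  §1.3] -/
def LatticeInstance.maxEntry (I : LatticeInstance) : ℕ :=
  Finset.univ.sup fun ij : Fin I.n × Fin I.n => (I.basis ij.1 ij.2).natAbs

/-- Every entry is bounded by `maxEntry` (Micciancio–Goldwasser 2002, Ch. 1, §1.3). [cite: MicciancioGoldwasser2002, Ch. 1  §1.3] -/
theorem LatticeInstance.natAbs_le_maxEntry (I : LatticeInstance) (i j : Fin I.n) :
    (I.basis i j).natAbs ≤ I.maxEntry :=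
  Finset.le_sup (f := fun ij : Fin I.n × Fin I.n => (I.basis ij.1 ij.2).natAbs)
    (Finset.mem_univ (i, j))

/-- Length of the code of an integer: `|encodeInt z| ≤ log₂ |z| + 7` (sign bit doubled,
separator, binary digits; Arora–Barak 2009, §0.1). [cite: AroraBarak2009, §0.1] -/
def length_encodeInt_le : Prop :=
  ∀ (z : ℤ),
    (encodeInt z).length ≤ Nat.log 2 z.natAbs + 7

/-- Polynomial size of lattice instances: there is an absolute constant `C` with
`|encode B| ≤ C · (n + 1)² · (log₂ (1 + max |B i j|) + 1)` for every `B ∈ ℤⁿˣⁿ`; in particular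
the input size is polynomial in `n` and `log max |B i j|`, and conversely `n ≤ |encode B|`
(Micciancio–Goldwasser 2002, Ch. 1, §1.3, size of the input; Arora–Barak 2009, §0.1). [cite: MicciancioGoldwasser2002, Ch. 1  §1.3  size of the input] -/
def LatticeInstance.length_encode_le : Prop :=
  ∃ C : ℕ, ∀ I : LatticeInstance,
      I.encode.length ≤ C * (I.n + 1) ^ 2 * (Nat.log 2 (I.maxEntry + 1) + 1)

/-- The dimension is bounded by the input size: `n ≤ |encode B|` (the unary length header of
the entry list alone has `n²` bits; Micciancio–Goldwasser 2002, Ch. 1, §1.3). [cite: MicciancioGoldwasser2002, Ch. 1  §1.3] -/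
theorem LatticeInstance.n_le_length_encode (I : LatticeInstance) : I.n ≤ I.encode.length := by
  rw [I.encode_eq, List.length_append]
  simp only [encodingIntMatrixFin, Encoding.ofEquiv_encode, encodingFinVec, Encoding.listBool,
    length_boolPair, List.length_ofFn]
  have h : ∀ k : ℕ, (unaryEncodeNat k).length = k := fun k => by
    induction k with
    | zero => rfl
    | succ k ih => simp [unaryEncodeNat, ih]
  rw [h]
  nlinarith [Nat.zero_le (encodeNatSD I.n).length]

end Literature.Algebra.EuclideanLattices
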